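import Summits.HodgeConjecture.HodgeConjecture.Theses.EndoscopicMiddleDegree
import Summits.HodgeConjecture.HodgeConjecture.Theorems.SectorComplement.Negative.ReductionToSummit
import Literature.AlgebraicGeometry.HodgeTheory.LefschetzOneOne
import Literature.AlgebraicGeometry.HodgeTheory.AbsoluteHodgeClasses

/-!
# Crux-ideate round 2, ideator 4 — `SectorComplement` (stmt-HodgeConjecture-14353): first lemmas

`SectorComplement := MiddleDegreeStep → _root_.HodgeConjecture`. Round 1's three lines died of the
mechanical costume rule `composition_iff : (S → SectorComplement) ↔ (S ∧ MiddleDegreeStep → HC)`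
(FunnelSalvage.lean): every stub conjunction `S` CONSISTENT with the target carries the residual
"HC off an enlarged sector". The ONE escape is a stub conjunction that REFUTES the target:
then `S ∧ MiddleDegreeStep` is empty and the frame follows from Disproof §4
(`sectorComplement_of_not_middleDegreeStep`). Both round-2 cards of this ideator live there; this file
checks their shared composition (m = 1 and m = 2) and the certificate-folded variant.
-/

set_option linter.dupNamespace false

namespace Summit.HodgeConjecture.HodgeConjecture.Cruxes.SectorComplement.IdeatorFour

open Summit.HodgeConjecture.HodgeConjecture.Theses.EndoscopicMiddleDegree
open Summit.HodgeConjecture.HodgeConjecture.Theorems.SectorComplement.Negative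
  (sectorComplement_iff_not_middleDegreeStep_or)
open Literature.AlgebraicGeometry Literature.AlgebraicGeometry.HodgeTheory
  Literature.AlgebraicGeometry.Motives Literature.AlgebraicGeometry.ShimuraVarieties

/-- Printed stub (Deligne 1982, Ex. 2.1(a); Charles–Schnell §11.2.2): cycle classes are absolute Hodge.
Not in the tree (needs `ConjugationChart` constructions: Jouanolou + GAGA + Grothendieck comparison). -/
def CycleClassesAbsoluteHodge : Prop :=
  ∀ ⦃n : ℕ⦄ ⦃X : SchemeOver ℂ⦄, IsSmoothProjective n X →
    ∀ (p : ℕ) (c : complexBetti X (2 * p)), IsRationalClass c → IsOfHodgeType n X (2 * p) p p c →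
      c ∈ algebraicClasses X p → IsAbsoluteHodgeClass n X p c

/-- THE WITNESS at m = 1 (the bet of both lines; its two attacks are the two cards): a rational Hodge
`(2,2)`-class on a compact arithmetic 4-ball quotient of simple unitary type that is NOT absolute Hodge
(de Rham conjugation clause fails for some `σ ∈ Aut ℂ`). -/
def NonAbsoluteSectorClass : Prop :=
  ∃ (X : SchemeOver ℂ) (_ : UnitaryBallQuotientDatum (2 * (1 + 1)) X)
    (c : complexBetti X (2 * (1 + 1))),
    IsRationalClass c ∧ IsOfHodgeType (2 * (1 + 1)) X (2 * (1 + 1)) (1 + 1) (1 + 1) c ∧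
      ¬ IsAbsoluteHodgeClass (2 * (1 + 1)) X (1 + 1) c

/-- THE WITNESS at m = 2: a non-absolute-Hodge rational `(3,3)`-class on a compact arithmetic 6-ball
quotient. -/
def NonAbsoluteSectorClassSix : Prop :=
  ∃ (X : SchemeOver ℂ) (_ : UnitaryBallQuotientDatum (2 * (2 + 1)) X)
    (c : complexBetti X (2 * (2 + 1))),
    IsRationalClass c ∧ IsOfHodgeType (2 * (2 + 1)) X (2 * (2 + 1)) (2 + 1) (2 + 1) c ∧
      ¬ IsAbsoluteHodgeClass (2 * (2 + 1)) X (2 + 1) c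

/-- BMM Cor. 2 at `(p, n) = (6, 2)`: HC in degree 4 on compact 6-ball quotients of the family (printed,
conditional on the twisted weighted fundamental lemma per the tree doc of `bmm2016_hodge_offMiddleThird`);
the lower-degree input of `MiddleDegreeStep` at `m = 2`. -/
def BMMSixTwo : Prop :=
  ∀ X : SchemeOver ℂ, Nonempty (UnitaryBallQuotientDatum (2 * (2 + 1)) X) →
    ∀ a : complexBetti X (2 * 2), IsRationalClass a →
      IsOfHodgeType (2 * (2 + 1)) X (2 * 2) 2 2 a → a ∈ algebraicClasses X 2

/-- Certificate-folded witness (card `tate-free-core-witness`: the Galois certificate "a rational Hodge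
class with a component in a potentially-Tate-free Hecke piece is not algebraic" has no étale vocabulary in
the tree, so the stub records its OUTPUT): a rational Hodge `(2,2)`-class outside `algebraicClasses`. -/
def NonAlgebraicSectorClass : Prop :=
  ∃ (X : SchemeOver ℂ) (_ : UnitaryBallQuotientDatum (2 * (1 + 1)) X)
    (c : complexBetti X (2 * (1 + 1))),
    IsRationalClass c ∧ IsOfHodgeType (2 * (1 + 1)) X (2 * (1 + 1)) (1 + 1) (1 + 1) c ∧
      c ∉ algebraicClasses X (1 + 1)

/-! ## Disproof §4 via the LANDED Negative lemma `ReductionToSummit.sectorComplement_iff_not_middleDegreeStep_or` -/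

/-- An on-sector failure of the target proves the frame — the `Or.inl` branch of the landed truth-table
lemma `Negative.sectorComplement_iff_not_middleDegreeStep_or`. [folklore] -/
theorem sectorComplement_of_not_middleDegreeStep (h : ¬ MiddleDegreeStep) : SectorComplement :=
  sectorComplement_iff_not_middleDegreeStep_or.2 (Or.inl h)

/-- Costume audit, generic form (FunnelSalvage `composition_iff`): a stub conjunction `S` yields the crux
iff `S ∧ MiddleDegreeStep → HC`. [folklore] -/
theorem composition_iff (S : Prop) :
    (S → SectorComplement) ↔ (S ∧ MiddleDegreeStep → _root_.HodgeConjecture) :=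
  ⟨fun h hs ↦ h hs.1 hs.2, fun h hs hM ↦ h ⟨hs, hM⟩⟩

/-- … and when `S` REFUTES the target the residual is vacuous: no "HC off the sector" stub is needed.
This is the escape from round 1's no-skeleton verdicts. [folklore] -/
theorem composition_of_refutes_target {S : Prop} (hS : S → ¬ MiddleDegreeStep) : S → SectorComplement :=
  fun hs ↦ sectorComplement_of_not_middleDegreeStep (hS hs)

/-! ## The shared composition of both round-2 lines -/

/-- m = 1: a non-absolute-Hodge rational `(2,2)`-class on a sector fourfold refutes the target, modulo
cycle-classes-AH and Lefschetz `(1,1)` (the target's own lower-degree input at `m = 1`).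
[cite: CharlesSchnell2014Notes, Def. 11.2.3] -/
theorem not_middleDegreeStep_of_witness (hAH : CycleClassesAbsoluteHodge)
    (hL : lefschetzOneOne_rational) (hW : NonAbsoluteSectorClass) : ¬ MiddleDegreeStep := by
  rintro hS
  obtain ⟨X, D, c, hc, hH, hnot⟩ := hW
  refine hnot (hAH D.isSmoothProjective (1 + 1) c hc hH ?_)
  exact hS 1 X le_rfl one_le_two ⟨D⟩ (fun a ha h11 ↦ hL D.isSmoothProjective a ha h11) c hc hH

/-- FIRST LEMMA (m = 1) of cards `lagrangian-period-obstruction` and `tate-free-core-witness`: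
`NonAbsoluteSectorClass → CycleClassesAbsoluteHodge → lefschetzOneOne_rational → SectorComplement`.
The would-be skeleton: stub_witness (the bet; attacked by O(V₀)-periods resp. Galois irreducibility),
stub_cycleAH (printed), stub_lefschetz (printed, tree-named), composition below (no residual stub).
[folklore] -/
theorem sectorComplement_of_witness (hW : NonAbsoluteSectorClass) (hAH : CycleClassesAbsoluteHodge)
    (hL : lefschetzOneOne_rational) : SectorComplement :=
  sectorComplement_of_not_middleDegreeStep (not_middleDegreeStep_of_witness hAH hL hW)

/-- m = 2 variant: a non-absolute-Hodge rational `(3,3)`-class on a sector sixfold, modulo cycle-classes-AH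
and BMM Cor. 2 at (6,2). [cite: BergeronMillsonMoeglin2016Balls, Cor. 2] -/
theorem sectorComplement_of_witnessSix (hW : NonAbsoluteSectorClassSix)
    (hAH : CycleClassesAbsoluteHodge) (hB : BMMSixTwo) : SectorComplement := by
  refine sectorComplement_of_not_middleDegreeStep fun hS ↦ ?_
  obtain ⟨X, D, c, hc, hH, hnot⟩ := hW
  refine hnot (hAH D.isSmoothProjective (2 + 1) c hc hH ?_)
  exact hS 2 X one_le_two le_rfl ⟨D⟩ (hB X ⟨D⟩) c hc hH

/-- Certificate-folded composition (card `tate-free-core-witness`):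
`NonAlgebraicSectorClass → lefschetzOneOne_rational → SectorComplement`. [folklore] -/
theorem sectorComplement_of_nonAlgebraic (hW : NonAlgebraicSectorClass)
    (hL : lefschetzOneOne_rational) : SectorComplement := by
  refine sectorComplement_of_not_middleDegreeStep fun hS ↦ ?_
  obtain ⟨X, D, c, hc, hH, hnot⟩ := hW
  exact hnot (hS 1 X le_rfl one_le_two ⟨D⟩ (fun a ha h11 ↦ hL D.isSmoothProjective a ha h11) c hc hH)

/-- Direction of the bet, recorded: the witness is a bet AGAINST the Hodge conjecture (granting
cycle-classes-AH) — the lines decide the crux exactly in the one world where the item can ever close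
short of a proof of HC (`Disproof.sectorComplement_iff_not_step_or_hc`). [folklore] -/
theorem not_hodgeConjecture_of_witness (hAH : CycleClassesAbsoluteHodge) (hW : NonAbsoluteSectorClass) :
    ¬ _root_.HodgeConjecture := by
  rintro hHC
  obtain ⟨X, D, c, hc, hH, hnot⟩ := hW
  exact hnot (hAH D.isSmoothProjective (1 + 1) c hc hH ((hHC D.isSmoothProjective).2 (1 + 1) c hc hH))

/-- Conversely, in the HC-world the witness stub is FALSE (so a prover of the line must expect the
cdisprove seat to aim here; the card's cheapest falsifier is a proof of the kernel's de Rham rationality,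
not of HC). [folklore] -/
theorem not_witness_of_hodgeConjecture (hAH : CycleClassesAbsoluteHodge) (hHC : _root_.HodgeConjecture) :
    ¬ NonAbsoluteSectorClass :=
  fun hW ↦ not_hodgeConjecture_of_witness hAH hW hHC

end Summit.HodgeConjecture.HodgeConjecture.Cruxes.SectorComplement.IdeatorFour
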